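import Mathlib
import HarnessLib

/-!
# Hata 1993: irrationality measures from the rates of rational approximations — definition and core argument
# (Acta Arith. 63 (1993) 335–349, §1 and the proof of Lemma 2.1)

Topic `Literature/NumberTheory/Irrationality/Hata1993` (file 1 of 2; the statements Remark 2.1 / Lemma 2.1 are
proved in `IrrationalityMeasure.lean`).  Read on the page from M. Hata, *Rational approximations to π and
some other numbers*, Acta Arith. **63** (1993) 335–349 [Hata1993Pi] (materialised text
`paper:doi-10-4064-aa-63-4-335-349`, pp. 335, 337–339).

* p. 335 (definition): "we say that a real number `γ` has an irrationality measure `µ ≥ 2` provided that,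
  for any `ε > 0`, there exists a positive integer `q₀(ε)` satisfying `|γ − p/q| ≥ q^{−µ−ε}` for any
  integers `p, q` with `q ≥ q₀(ε)`."  — `HasIrrationalityMeasure`, with the bridge
  `HasIrrationalityMeasure.not_liouvilleWith` to Mathlib's `LiouvilleWith` (the vocabulary of the tree's
  record statements `Zudilin2014.zetaTwo_irrationalityExponent_le`,
  `RhinViola2001.zetaThree_irrationalityExponent_lt` and of the cell pub-zeta5's C4 files).
* pp. 338–339, the proof of Lemma 2.1 (cases (a)/(b) with `N(H)` = least `N` with `4W < e^{(τ−δ)N}` and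
  `M(H)` = least index `≥ N(H)` with `Aₙ ≠ 0`), written ONCE in log-linear form as
  `log_lower_bound_core`: a non-zero real `Λ` with `qₙΛ = Aₙ + ωₙ`, `Aₙ ∈ ℤ`, `e^{bn} ≤ |qₙ| ≤ e^{an}`,
  `|ωₙ| ≤ W e^{−tn}` for `n ≥ N₀` (`e^{t(N₀+1)} ≤ 4W`) and `Aₙ ≠ 0` for arbitrarily large `n` satisfies
  `log|Λ| ≥ −K(a,b,t) − (a/(b+t−a))·log W`; plus the two elementary side steps of the printed proof
  (`exists_ne_zero_of_ne_zero`: "the set `Ω` is infinite"; `exists_delta`: the choice of `δ(ε)`).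

Cell pub-zeta5 (HONEST FRAMING: systematic search; no irrationality claim unless certified): the closing
device of the printed record irrationality measures (Rhin–Viola 1996/2001, Zudilin 2014, Marcovecchio–Zudilin
2020 cite "[Ha93, Lemma 2.1]"); nothing here is a new arithmetic claim.
-/

noncomputable section

open Filter Real

namespace Literature.NumberTheory.Irrationality.Hata1993

/-- **Hata's definition of an irrationality measure** (p. 335): `γ` has an irrationality measure `μ` iff for
every `ε > 0` there is a positive integer `q₀(ε)` with `|γ − p/q| ≥ q^{−μ−ε}` for all integers `p, q` with
`q ≥ q₀(ε)`.  (The source adds "`µ ≥ 2`", automatic for irrational `γ` by Dirichlet; not part of the defining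
condition.) [cite: Hata1993Pi, §1 p. 335] -/
def HasIrrationalityMeasure (γ μ : ℝ) : Prop :=
  ∀ ε : ℝ, 0 < ε → ∃ q₀ : ℕ, 0 < q₀ ∧
    ∀ p q : ℤ, (q₀ : ℤ) ≤ q → (q : ℝ) ^ (-(μ + ε)) ≤ |γ - p / q|

/-- Monotonicity in the exponent (immediate from the definition: `q^{−μ'−ε} ≤ q^{−μ−ε}` for `q ≥ 1`,
`μ ≤ μ'`). [cite: Hata1993Pi, §1 p. 335] -/
theorem HasIrrationalityMeasure.mono {γ μ μ' : ℝ} (h : HasIrrationalityMeasure γ μ) (hμ : μ ≤ μ') :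
    HasIrrationalityMeasure γ μ' := by
  intro ε hε
  obtain ⟨q₀, hq₀, hq⟩ := h ε hε
  refine ⟨q₀, hq₀, fun p q hqq => le_trans ?_ (hq p q hqq)⟩
  have hq1 : (1 : ℝ) ≤ q := by exact_mod_cast (show (1 : ℤ) ≤ q by omega)
  exact Real.rpow_le_rpow_of_exponent_le hq1 (by linarith)

/-- **Bridge to Mathlib's `LiouvilleWith`** (the vocabulary of the tree's record statements): an
irrationality measure `μ` in Hata's sense excludes `LiouvilleWith p` for every `p > μ`.
[cite: Hata1993Pi, §1 p. 335] -/
theorem HasIrrationalityMeasure.not_liouvilleWith {γ μ p : ℝ} (h : HasIrrationalityMeasure γ μ)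
    (hp : μ < p) : ¬ LiouvilleWith p γ := by
  rintro ⟨C, hC⟩
  -- ε with μ + 2ε = p
  obtain ⟨q₀, hq₀, hq⟩ := h ((p - μ) / 2) (by linarith)
  -- eventually (in n) C < n^{(p-μ)/2}, so C / n^p < n^{-(μ + (p-μ)/2)}
  have hev : ∀ᶠ n : ℕ in atTop, (q₀ : ℕ) ≤ n ∧ C < (n : ℝ) ^ ((p - μ) / 2) := by
    refine (eventually_ge_atTop q₀).and ?_
    have ht : Tendsto (fun n : ℕ => (n : ℝ) ^ ((p - μ) / 2)) atTop atTop :=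
      (tendsto_rpow_atTop (by linarith)).comp tendsto_natCast_atTop_atTop
    exact ht.eventually_gt_atTop C
  obtain ⟨n, ⟨hnq, hnC⟩, m, _, hlt⟩ := (hev.and_frequently hC).exists
  have hn0 : (0 : ℝ) < n := by exact_mod_cast (lt_of_lt_of_le hq₀ hnq)
  have key := hq m n (by exact_mod_cast hnq)
  -- n^{-(μ+ε)} ≤ |γ - m/n| < C/n^p < n^{(p-μ)/2}/n^p = n^{-(μ+ε)}
  have h1 : C / (n : ℝ) ^ p < (n : ℝ) ^ ((p - μ) / 2) / (n : ℝ) ^ p :=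
    div_lt_div_of_pos_right hnC (Real.rpow_pos_of_pos hn0 _)
  have h2 : (n : ℝ) ^ ((p - μ) / 2) / (n : ℝ) ^ p = (n : ℝ) ^ (-(μ + (p - μ) / 2)) := by
    rw [← Real.rpow_sub hn0]; congr 1; ring
  have key' : ((n : ℤ) : ℝ) ^ (-(μ + (p - μ) / 2)) ≤ |γ - m / ((n : ℤ) : ℝ)| := key
  push_cast at key'
  linarith

/-! ### The core of the printed proof (pp. 338–339), in log-linear form

Data: a non-zero real `Λ` written as `qₙΛ = Aₙ + ωₙ` with `Aₙ ∈ ℤ`, where for `n ≥ N₀`: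
`e^{bn} ≤ |qₙ| ≤ e^{an}`, `|ωₙ| ≤ W e^{−tn}` (`a, t > 0`, `a < b + t`, `W ≥ 1`, and the threshold
`e^{t(N₀+1)} ≤ 4W`), and `Aₙ ≠ 0` for arbitrarily large `n`.  Conclusion:
`log|Λ| ≥ −K − (a/(b+t−a))·log W` with `K = K(a,b,t)` explicit.  In the applications `a = σ+δ`, `b = σ−δ`,
`t = τ−δ`, so `a/(b+t−a) = (σ+δ)/(τ−3δ)`. -/

/-- The constant `K(a,b,t)` of `log_lower_bound_core`: the explicit constants `½e^{−(σ+δ)}`,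
`(4e^{σ+τ})^{−1−2σ/τ}` of the printed cases (a)/(b) in log form (any explicit expression would do).
[cite: Hata1993Pi, Lemma 2.1 (proof, pp. 338–339)] -/
def coreConst (a b t : ℝ) : ℝ :=
  max (Real.log 2 + a + a * Real.log 4 / t) ((Real.log 2 + a) * (b + t) / (b + t - a))

/-- `K(a,b,t) ≥ 0` for `a, t > 0`. [cite: Hata1993Pi, Lemma 2.1 (proof, pp. 338–339)] -/
theorem coreConst_nonneg {a b t : ℝ} (ha : 0 < a) (ht : 0 < t) : 0 ≤ coreConst a b t := by
  unfold coreConst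
  refine le_max_of_le_left ?_
  have h2 : 0 ≤ Real.log 2 := Real.log_nonneg (by norm_num)
  have h4 : 0 ≤ Real.log 4 := Real.log_nonneg (by norm_num)
  have h3 : 0 ≤ a * Real.log 4 / t := div_nonneg (mul_nonneg ha.le h4) ht.le
  linarith

/-- **Core of Hata's argument** (proof of Lemma 2.1, pp. 338–339, cases (a) and (b)), log-linear form.
[cite: Hata1993Pi, Lemma 2.1 (proof)] -/
theorem log_lower_bound_core {Λ W a b t : ℝ} {q : ℕ → ℤ} {A : ℕ → ℤ} {ω : ℕ → ℝ} {N₀ : ℕ}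
    (hΛ : Λ ≠ 0) (hW : 1 ≤ W) (ha : 0 < a) (ht : 0 < t) (hs : a < b + t) (hba : b ≤ a)
    (hq : ∀ n, N₀ ≤ n → Real.exp (b * n) ≤ |(q n : ℝ)| ∧ |(q n : ℝ)| ≤ Real.exp (a * n))
    (hω : ∀ n, N₀ ≤ n → |ω n| ≤ W * Real.exp (-(t * n)))
    (hid : ∀ n, N₀ ≤ n → (q n : ℝ) * Λ = A n + ω n)
    (hΩ : ∀ n₁ : ℕ, ∃ n, n₁ ≤ n ∧ A n ≠ 0)
    (hthr : Real.exp (t * (N₀ + 1)) ≤ 4 * W) :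
    -coreConst a b t - a / (b + t - a) * Real.log W ≤ Real.log |Λ| := by
  have hW0 : 0 < W := by linarith
  have hΛpos : 0 < |Λ| := abs_pos.2 hΛ
  have hlogW : 0 ≤ Real.log W := Real.log_nonneg hW
  have hsa : 0 < b + t - a := by linarith
  set s := b + t with hs_def
  -- N₁ = N(H): the least N with 4W < e^{tN}
  have hex : ∃ N : ℕ, 4 * W < Real.exp (t * N) := by
    obtain ⟨N, hN⟩ := exists_nat_gt (Real.log (4 * W) / t)
    refine ⟨N, ?_⟩
    have hN' : Real.log (4 * W) < N * t := (div_lt_iff₀ ht).1 hN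
    have : Real.log (4 * W) < t * N := by linarith
    calc 4 * W = Real.exp (Real.log (4 * W)) := (Real.exp_log (by positivity)).symm
      _ < Real.exp (t * N) := Real.exp_lt_exp.2 this
  classical
  set N₁ := Nat.find hex with hN₁_def
  have hN₁ : 4 * W < Real.exp (t * N₁) := Nat.find_spec hex
  have hN₁min : ∀ m, m < N₁ → ¬ 4 * W < Real.exp (t * m) := fun m hm => Nat.find_min hex hm
  -- N₁ ≥ N₀ + 2
  have hN₁ge : N₀ + 2 ≤ N₁ := by
    by_contra hlt
    have hle : (N₁ : ℝ) ≤ N₀ + 1 := by exact_mod_cast (show N₁ ≤ N₀ + 1 by omega)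
    have : Real.exp (t * N₁) ≤ Real.exp (t * (N₀ + 1)) :=
      Real.exp_le_exp.2 (mul_le_mul_of_nonneg_left hle ht.le)
    linarith
  -- e^{t(N₁-1)} ≤ 4W  (minimality at N₁ - 1)
  have hN₁prev : Real.exp (t * ((N₁ : ℝ) - 1)) ≤ 4 * W := by
    have h := hN₁min (N₁ - 1) (by omega)
    push Not at h
    have hc : (((N₁ - 1 : ℕ) : ℝ)) = (N₁ : ℝ) - 1 := by
      norm_num [Nat.cast_sub (show 1 ≤ N₁ by omega)]
    rw [hc] at h; exact h
  -- for n ≥ N₁: |ω n| < 1/4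
  have hωsmall : ∀ n, N₁ ≤ n → |ω n| < 1 / 4 := by
    intro n hn
    have h1 := hω n (by omega)
    have hN₁n : (N₁ : ℝ) ≤ n := by exact_mod_cast hn
    have h2 : Real.exp (-(t * n)) ≤ Real.exp (-(t * N₁)) :=
      Real.exp_le_exp.2 (by nlinarith)
    have h3 : W * Real.exp (-(t * N₁)) < 1 / 4 := by
      rw [Real.exp_neg]
      have hE : 0 < Real.exp (t * N₁) := Real.exp_pos _
      rw [mul_inv_lt_iff₀ hE]; linarith
    calc |ω n| ≤ W * Real.exp (-(t * n)) := h1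
      _ ≤ W * Real.exp (-(t * N₁)) := mul_le_mul_of_nonneg_left h2 hW0.le
      _ < 1 / 4 := h3
  -- M = M(H): least n ≥ N₁ with A n ≠ 0
  have hexM : ∃ n, N₁ ≤ n ∧ A n ≠ 0 := hΩ N₁
  set M := Nat.find hexM with hM_def
  have hM : N₁ ≤ M ∧ A M ≠ 0 := Nat.find_spec hexM
  have hMmin : ∀ m, m < M → ¬ (N₁ ≤ m ∧ A m ≠ 0) := fun m hm => Nat.find_min hexM hm
  have hMN₀ : N₀ ≤ M := by omega
  -- (2.1) at n = M:  log|Λ| ≥ -log 2 - a M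
  have h21 : -Real.log 2 - a * M ≤ Real.log |Λ| := by
    have hAM : (1 : ℝ) ≤ |(A M : ℝ)| := by
      rw [← Int.cast_abs]; exact_mod_cast Int.one_le_abs hM.2
    have hωM := hωsmall M hM.1
    have hidM := hid M hMN₀
    have hqM := (hq M hMN₀).2
    -- |q M| |Λ| = |A M + ω M| ≥ 3/4
    have h34 : 3 / 4 ≤ |(q M : ℝ)| * |Λ| := by
      rw [← abs_mul, hidM]
      have h' : |(A M : ℝ)| - |ω M| ≤ |(A M : ℝ) + ω M| := by
        have := abs_add_le ((A M : ℝ) + ω M) (-(ω M))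
        simp only [add_neg_cancel_right, abs_neg] at this
        linarith
      linarith
    -- hence |Λ| e^{aM} ≥ 3/4 ≥ 1/2
    have h12 : 1 / 2 ≤ |Λ| * Real.exp (a * M) := by
      have : |(q M : ℝ)| * |Λ| ≤ Real.exp (a * M) * |Λ| :=
        mul_le_mul_of_nonneg_right hqM hΛpos.le
      linarith
    have hlog := Real.log_le_log (by norm_num) h12
    rw [Real.log_mul hΛpos.ne' (Real.exp_pos _).ne', Real.log_exp,
      show Real.log (1 / 2 : ℝ) = -Real.log 2 by rw [one_div, Real.log_inv]] at hlog
    linarith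
  have hlog2 : 0 ≤ Real.log 2 := Real.log_nonneg (by norm_num)
  have hlog4 : 0 ≤ Real.log 4 := Real.log_nonneg (by norm_num)
  have hK : ∀ x, x = Real.log 2 + a + a * Real.log 4 / t ∨ x = (Real.log 2 + a) * s / (s - a) →
      x ≤ coreConst a b t := by
    rintro x (rfl | rfl)
    · exact le_max_left _ _
    · exact le_max_right _ _
  -- the slope a/t ≤ a/(s-a)
  have hslope : a / t ≤ a / (s - a) :=
    div_le_div_of_nonneg_left ha.le hsa (by linarith)
  have hsane : s - a ≠ 0 := hsa.ne'
  have htne : t ≠ 0 := ht.ne'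
  rcases Nat.lt_or_ge N₁ M with hlt | hge
  · -- case (b): M > N₁, A (M-1) = 0
    have hAM1 : A (M - 1) = 0 := by
      have h := hMmin (M - 1) (by omega)
      push Not at h
      exact h (by omega)
    have hM1N₀ : N₀ ≤ M - 1 := by omega
    have hidM1 := hid (M - 1) hM1N₀
    rw [hAM1, Int.cast_zero, zero_add] at hidM1
    have hqM1 := (hq (M - 1) hM1N₀).1
    have hωM1 := hω (M - 1) hM1N₀
    have hcast : (((M - 1 : ℕ) : ℝ)) = (M : ℝ) - 1 := by
      norm_num [Nat.cast_sub (show 1 ≤ M by omega)]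
    rw [hcast] at hqM1 hωM1
    -- |Λ| e^{b(M-1)} ≤ |q_{M-1}| |Λ| = |ω_{M-1}| ≤ W e^{-t(M-1)}
    have hup : |Λ| * Real.exp (b * ((M : ℝ) - 1)) ≤ W * Real.exp (-(t * ((M : ℝ) - 1))) := by
      have h1 : |Λ| * Real.exp (b * ((M : ℝ) - 1)) ≤ |Λ| * |(q (M - 1) : ℝ)| :=
        mul_le_mul_of_nonneg_left hqM1 hΛpos.le
      have h2 : |Λ| * |(q (M - 1) : ℝ)| = |ω (M - 1)| := by
        rw [← abs_mul, mul_comm, hidM1]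
      linarith
    -- take logs: log|Λ| + b(M-1) ≤ log W - t(M-1)
    have hlogup := Real.log_le_log (mul_pos hΛpos (Real.exp_pos _)) hup
    rw [Real.log_mul hΛpos.ne' (Real.exp_pos _).ne', Real.log_exp,
      Real.log_mul hW0.ne' (Real.exp_pos _).ne', Real.log_exp] at hlogup
    -- so s (M - 1) ≤ log W - log|Λ|, and (2.1): log|Λ| ≥ -log 2 - a M
    have hsM : s * ((M : ℝ) - 1) ≤ Real.log W - Real.log |Λ| := by rw [hs_def]; linarith
    -- multiply hsM by a ≥ 0 and h21-type bound by s > 0, combine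
    have h1 : a * (s * ((M : ℝ) - 1)) ≤ a * (Real.log W - Real.log |Λ|) :=
      mul_le_mul_of_nonneg_left hsM ha.le
    have hspos : 0 < s := by linarith
    -- from h21: a*M ≥ ... ⇒ s*(−log 2 − a M) ≤ s log|Λ|
    have h2 : s * (-Real.log 2 - a * M) ≤ s * Real.log |Λ| :=
      mul_le_mul_of_nonneg_left h21 hspos.le
    -- (s - a) log|Λ| ≥ -(log 2 + a) s - a log W
    have h3 : -(Real.log 2 + a) * s - a * Real.log W ≤ (s - a) * Real.log |Λ| := by nlinarith
    have h4 : -((Real.log 2 + a) * s / (s - a)) - a / (s - a) * Real.log W ≤ Real.log |Λ| := by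
      rw [show -((Real.log 2 + a) * s / (s - a)) - a / (s - a) * Real.log W =
        (-(Real.log 2 + a) * s - a * Real.log W) / (s - a) by field_simp]
      rw [div_le_iff₀ hsa]; linarith
    have hK2 := hK _ (Or.inr rfl)
    have : -coreConst a b t ≤ -((Real.log 2 + a) * s / (s - a)) := by linarith
    linarith
  · -- case (a): M = N₁
    have hMeq : M = N₁ := le_antisymm hge hM.1
    -- t (N₁ - 1) ≤ log (4W) = log 4 + log W
    have hlogN := Real.log_le_log (Real.exp_pos _) hN₁prev
    rw [Real.log_exp, Real.log_mul (by norm_num) hW0.ne'] at hlogN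
    -- N₁ ≤ 1 + (log 4 + log W)/t ; log|Λ| ≥ -log 2 - a N₁
    rw [hMeq] at h21
    have h1 : a * (t * ((N₁ : ℝ) - 1)) ≤ a * (Real.log 4 + Real.log W) :=
      mul_le_mul_of_nonneg_left hlogN ha.le
    -- t log|Λ| ≥ -t log 2 - a t N₁ ≥ -t log 2 - a t - a (log 4 + log W)
    have h2 : t * (-Real.log 2 - a * N₁) ≤ t * Real.log |Λ| := mul_le_mul_of_nonneg_left h21 ht.le
    have h3 : -(Real.log 2 + a + a * Real.log 4 / t) - a / t * Real.log W ≤ Real.log |Λ| := by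
      rw [show -(Real.log 2 + a + a * Real.log 4 / t) - a / t * Real.log W =
        (-(t * Real.log 2) - a * t - a * Real.log 4 - a * Real.log W) / t by field_simp; ring]
      rw [div_le_iff₀ ht]; nlinarith
    have hK1 := hK _ (Or.inl rfl)
    have h5 : a / t * Real.log W ≤ a / (s - a) * Real.log W :=
      mul_le_mul_of_nonneg_right hslope hlogW
    have : -coreConst a b t ≤ -(Real.log 2 + a + a * Real.log 4 / t) := by linarith
    linarith

/-- Elementary: the set `Ω = {n : Aₙ ≠ 0}` is infinite when `Λ ≠ 0` (p. 338, first paragraph of the proof,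
single-constant version: if `Aₙ = 0` for all large `n` then `|Λ| = |ωₙ/qₙ| → 0`).
[cite: Hata1993Pi, Lemma 2.1 (proof)] -/
theorem exists_ne_zero_of_ne_zero {Λ W b t : ℝ} {q : ℕ → ℤ} {A : ℕ → ℤ} {ω : ℕ → ℝ} {N₀ : ℕ}
    (hΛ : Λ ≠ 0) (hW : 0 < W) (hs : 0 < b + t)
    (hq : ∀ n, N₀ ≤ n → Real.exp (b * n) ≤ |(q n : ℝ)|)
    (hω : ∀ n, N₀ ≤ n → |ω n| ≤ W * Real.exp (-(t * n)))
    (hid : ∀ n, N₀ ≤ n → (q n : ℝ) * Λ = A n + ω n) (n₁ : ℕ) :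
    ∃ n, n₁ ≤ n ∧ A n ≠ 0 := by
  by_contra hcon
  push Not at hcon
  have hΛpos : 0 < |Λ| := abs_pos.2 hΛ
  -- pick n ≥ max n₁ N₀ with W e^{-(b+t) n} < |Λ|
  obtain ⟨n, hn⟩ := exists_nat_gt (max ((Real.log W - Real.log |Λ|) / (b + t)) (max (n₁ : ℝ) N₀))
  have hn1 : n₁ ≤ n := by
    have : (n₁ : ℝ) < n := lt_of_le_of_lt ((le_max_left _ _).trans (le_max_right _ _)) hn
    exact_mod_cast this.le
  have hn0 : N₀ ≤ n := by
    have : (N₀ : ℝ) < n := lt_of_le_of_lt ((le_max_right _ _).trans (le_max_right _ _)) hn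
    exact_mod_cast this.le
  have hnr : (Real.log W - Real.log |Λ|) / (b + t) < n := lt_of_le_of_lt (le_max_left _ _) hn
  have hA := hcon n hn1
  have hidn := hid n hn0
  rw [hA, Int.cast_zero, zero_add] at hidn
  -- |Λ| e^{bn} ≤ |q n||Λ| = |ω n| ≤ W e^{-tn}
  have hup : |Λ| * Real.exp (b * n) ≤ W * Real.exp (-(t * n)) := by
    have h1 : |Λ| * Real.exp (b * n) ≤ |Λ| * |(q n : ℝ)| :=
      mul_le_mul_of_nonneg_left (hq n hn0) hΛpos.le
    have h2 : |Λ| * |(q n : ℝ)| = |ω n| := by rw [← abs_mul, mul_comm, hidn]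
    linarith [hω n hn0]
  have hlog := Real.log_le_log (mul_pos hΛpos (Real.exp_pos _)) hup
  rw [Real.log_mul hΛpos.ne' (Real.exp_pos _).ne', Real.log_exp,
    Real.log_mul hW.ne' (Real.exp_pos _).ne', Real.log_exp] at hlog
  have : Real.log W - Real.log |Λ| < (b + t) * n := by rwa [div_lt_iff₀ hs, mul_comm] at hnr
  linarith

/-- Choice of the auxiliary `δ = δ(ε)` of the printed proof (p. 338: "one can define a sufficiently small
`δ ∈ (0, τ/6)` satisfying `(σ+δ)/(τ−3δ) < σ/τ + ε/2`"); here `δ ≤ τ/7` and `≤`. [cite: Hata1993Pi, Lemma 2.1 (proof)] -/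
theorem exists_delta {σ τ ε : ℝ} (hσ : 0 < σ) (hτ : 0 < τ) (hε : 0 < ε) :
    ∃ δ : ℝ, 0 < δ ∧ δ ≤ τ / 7 ∧ (σ + δ) / (τ - 3 * δ) ≤ σ / τ + ε / 2 := by
  set κ := σ / τ + ε / 2 with hκ_def
  have hκpos : 0 < κ := by positivity
  have h13 : 0 < 1 + 3 * κ := by positivity
  refine ⟨min (τ / 7) (ε * τ / 2 / (1 + 3 * κ)), lt_min (by positivity) (by positivity),
    min_le_left _ _, ?_⟩
  set δ := min (τ / 7) (ε * τ / 2 / (1 + 3 * κ)) with hδ_def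
  have hδτ : δ ≤ τ / 7 := min_le_left _ _
  have hδκ : δ * (1 + 3 * κ) ≤ ε * τ / 2 := by
    have h : δ ≤ ε * τ / 2 / (1 + 3 * κ) := min_le_right _ _
    calc δ * (1 + 3 * κ) ≤ ε * τ / 2 / (1 + 3 * κ) * (1 + 3 * κ) :=
          mul_le_mul_of_nonneg_right h h13.le
      _ = ε * τ / 2 := div_mul_cancel₀ _ h13.ne'
  have h3 : 0 < τ - 3 * δ := by linarith
  rw [div_le_iff₀ h3]
  have hκτ : κ * τ = σ + ε * τ / 2 := by
    rw [hκ_def, add_mul, div_mul_cancel₀ σ hτ.ne']; ring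
  nlinarith

end Literature.NumberTheory.Irrationality.Hata1993
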